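import Summits.CriticalPhenomena.PercolationContinuityZ3.Theorems.PercNearOneGluingNoHeavyPcintUFibBip
import Summits.CriticalPhenomena.PercolationContinuityZ3.Theorems.PercNearOneGluingNoHeavyPcintAdaptiveDominationMarginals
import HarnessLib

/-!
# PCINT lane, T-fibre route PHASE 3 (bond), step (6a): breadth-first levels in a complete bipartite fibre

Cell `prim-pcint`, seat `prim-pcint-1` (gen 13); memo `run/shared/lean/prim/pcint/T-FIBRE-ROUTE.md` (PHASE 3).

The growth rule of the bond cells: in the complete bipartite fibre `K_{A,B} = UFib.bipGraph SA` (sides `SA`, `SAᶜ`), with the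
internal edge `{a, b}` read at the key `ekB SA a b` (`= (a, b)` if `a ∈ SA`, else `(b, a)`), the usable set of an entered site
is grown from its entry cell by BREADTH-FIRST LEVELS (`growL`, depth = fuel `D`): from the current level `L` the next level is
the set of not-yet-used cells of the opposite side joined to `L` by an open edge (`nxt`).

This file: the definitions, the soundness of the rule (`growL_joined`), elementary support facts (which keys a level
computation reads: `nxt_congr`, `growL_congr`), the product-measure independence of functions with disjoint supports
(`AdaptDom.sum_wt_mul_of_disjoint`) and the law of one level (`sum_wt_nxt_eq`: `P(nxt = S) = (1-q^ℓ)^{#S} (q^ℓ)^{#R-#S}`,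
`q = 1 - p`, `ℓ = #L`, the Reed–Frost / chain-binomial transition).  The size law itself is `…PcintBFibLevelsLaw.lean`.
-/

noncomputable section

namespace Summit.CriticalPhenomena.PercolationContinuityZ3.Theorems.Pcint

open Finset

/-! ### Independence of functions with disjoint supports under the product weight -/

namespace AdaptDom

variable {V : Type*} [Fintype V] [DecidableEq V]

/-- **Independence**: under `π_q`, a function reading only the coordinates of `S` and a function reading only the
coordinates off `S` are uncorrelated. -/
theorem sum_wt_mul_of_disjoint (q : ℝ) (S : Finset V) (f g : (V → Bool) → ℝ)
    (hf : ∀ y y', (∀ v ∈ S, y v = y' v) → f y = f y') (hg : ∀ y y', (∀ v, v ∉ S → y v = y' v) → g y = g y') :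
    ∑ y : V → Bool, wt q y * (f y * g y) = (∑ y : V → Bool, wt q y * f y) * ∑ y : V → Bool, wt q y * g y := by
  rw [← sum_sum_mix q S (fun y => f y * g y)]
  have e : ∀ y y' : V → Bool, f (mix S y y') * g (mix S y y') = f y * g y' := by
    intro y y'
    rw [hf (mix S y y') y (fun v hv => by simp [mix, hv]), hg (mix S y y') y' (fun v hv => by simp [mix, hv])]
  simp_rw [e]
  rw [Finset.sum_mul_sum]
  exact Finset.sum_congr rfl fun y _ => Finset.sum_congr rfl fun y' _ => by ring

/-- The `π_q`-mass of the configurations vanishing on `S` is `(1-q)^{#S}`. -/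
theorem sum_wt_filter_all_false (q : ℝ) (S : Finset V) :
    ∑ y ∈ univ.filter (fun y : V → Bool => ∀ v ∈ S, y v = false), wt q y = (1 - q) ^ S.card := by
  rw [sum_wt_filter_agree q S (fun _ => false), Finset.prod_const]
  rfl

end AdaptDom

namespace BFib

open AdaptDom UFib

variable {Φ : Type*} [DecidableEq Φ] (SA : Finset Φ)

/-! ### The edge key and the levels -/

/-- **The edge key of the complete bipartite fibre**: the internal edge `{a, b}` is read at `(a, b)` if `a ∈ SA`, else at
`(b, a)` (so the two orientations of an edge read the same bit). -/
def ekB (a b : Φ) : Φ × Φ := if a ∈ SA then (a, b) else (b, a)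

/-- **The next level**: the cells of `R` joined to some cell of `L` by an open edge. -/
def nxt (y : Φ × Φ → Bool) (L R : Finset Φ) : Finset Φ :=
  R.filter fun w => ∃ u ∈ L, (bipGraph SA).Adj u w ∧ y (ekB SA u w) = true

/-- **Breadth-first levels** with fuel `D`: from the current level `L`, with unused cells `RX` on the side of `L` and `RY` on
the other side, the union of the levels reached. -/
def growL (y : Φ × Φ → Bool) : ℕ → Finset Φ → Finset Φ → Finset Φ → Finset Φ
  | 0, L, _, _ => L
  | D + 1, L, RX, RY => L ∪ growL y D (nxt SA y L RY) (RY \ nxt SA y L RY) RX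

section Grow

variable [Fintype Φ]

/-- The side of a cell. -/
def sideOf (i : Φ) : Finset Φ := if i ∈ SA then SA else SAᶜ

/-- The side opposite to a cell. -/
def otherSide (i : Φ) : Finset Φ := if i ∈ SA then SAᶜ else SA

/-- **The growth rule of the bond cells**: breadth-first levels of depth `D` from the entry cell `i`. -/
def growB (D : ℕ) (y : Φ × Φ → Bool) (i : Φ) : Finset Φ := growL SA y D {i} ((sideOf SA i).erase i) (otherSide SA i)

end Grow

variable {SA}

/-- On adjacent pairs the key is symmetric. -/
theorem ekB_comm {a b : Φ} (h : (bipGraph SA).Adj a b) : ekB SA a b = ekB SA b a := by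
  unfold ekB
  rcases (bipGraph_adj SA).1 h with ⟨ha, hb⟩ | ⟨ha, hb⟩
  · rw [if_pos ha, if_neg hb]
  · rw [if_neg ha, if_pos hb]

/-- The key of a pair is one of its two orientations. -/
theorem ekB_mem (a b : Φ) : ekB SA a b = (a, b) ∨ ekB SA a b = (b, a) := by
  unfold ekB; split_ifs
  · exact Or.inl rfl
  · exact Or.inr rfl

/-- For a fixed second cell, the key is injective in the first cell (away from the diagonal). -/
theorem ekB_inj_left {u u' w : Φ} (hu : u ≠ w) (hu' : u' ≠ w) (h : ekB SA u w = ekB SA u' w) : u = u' := by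
  unfold ekB at h
  split_ifs at h with h1 h2 h2
  · exact (Prod.mk.inj h).1
  · exact absurd (Prod.mk.inj h).1 hu
  · exact absurd (Prod.mk.inj h).1.symm hu'
  · exact (Prod.mk.inj h).2

/-! ### Elementary facts about the levels -/

/-- The next level lies in `R`. -/
theorem nxt_subset (y : Φ × Φ → Bool) (L R : Finset Φ) : nxt SA y L R ⊆ R := filter_subset _ _

/-- The grown set lies in `L ∪ RX ∪ RY`. -/
theorem growL_subset (y : Φ × Φ → Bool) : ∀ (D : ℕ) (L RX RY : Finset Φ), growL SA y D L RX RY ⊆ L ∪ RX ∪ RY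
  | 0, L, RX, RY => by simp only [growL]; exact subset_union_left.trans subset_union_left
  | D + 1, L, RX, RY => by
    simp only [growL]
    refine union_subset (subset_union_left.trans subset_union_left) ?_
    refine (growL_subset y D _ _ _).trans ?_
    intro v hv
    rcases mem_union.1 hv with hv | hv
    · rcases mem_union.1 hv with hv | hv
      · exact mem_union_right _ (nxt_subset y L RY hv)
      · exact mem_union_right _ ((sdiff_subset) hv)
    · exact mem_union_left _ (mem_union_right _ hv)

/-- `L ⊆ growL`. -/
theorem subset_growL (y : Φ × Φ → Bool) : ∀ (D : ℕ) (L RX RY : Finset Φ), L ⊆ growL SA y D L RX RY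
  | 0, L, RX, RY => by simp only [growL]; exact Subset.rfl
  | D + 1, L, RX, RY => by simp only [growL]; exact subset_union_left

/-- **The cardinality recursion**: `#growL (D+1) L RX RY = #L + #growL D N (RY \ N) RX` when `L` is disjoint from
`RX ∪ RY`. -/
theorem card_growL_succ (y : Φ × Φ → Bool) (D : ℕ) {L RX RY : Finset Φ} (hLX : Disjoint L RX) (hLY : Disjoint L RY) :
    (growL SA y (D + 1) L RX RY).card =
      L.card + (growL SA y D (nxt SA y L RY) (RY \ nxt SA y L RY) RX).card := by
  simp only [growL]
  refine card_union_of_disjoint ?_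
  refine Finset.disjoint_left.2 fun v hvL hv => ?_
  have hsub := growL_subset (SA := SA) y D (nxt SA y L RY) (RY \ nxt SA y L RY) RX hv
  rcases mem_union.1 hsub with h | h
  · rcases mem_union.1 h with h | h
    · exact Finset.disjoint_left.1 hLY hvL (nxt_subset y L RY h)
    · exact Finset.disjoint_left.1 hLY hvL (sdiff_subset h)
  · exact Finset.disjoint_left.1 hLX hvL h

/-- **Soundness of the levels**: every grown cell is joined to a cell of `L` by open edges (read at the keys). -/
theorem growL_joined (y : Φ × Φ → Bool) : ∀ (D : ℕ) (L RX RY : Finset Φ) (j : Φ), j ∈ growL SA y D L RX RY →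
    ∃ i ∈ L, Relation.ReflTransGen (fun a b => (bipGraph SA).Adj a b ∧ y (ekB SA a b) = true) i j
  | 0, L, RX, RY, j, hj => by simp only [growL] at hj; exact ⟨j, hj, Relation.ReflTransGen.refl⟩
  | D + 1, L, RX, RY, j, hj => by
    simp only [growL] at hj
    rcases mem_union.1 hj with hj | hj
    · exact ⟨j, hj, Relation.ReflTransGen.refl⟩
    · obtain ⟨w, hw, hpath⟩ := growL_joined y D _ _ _ j hj
      unfold nxt at hw
      obtain ⟨-, u, huL, hadj, hy⟩ := mem_filter.1 hw
      exact ⟨u, huL, (Relation.ReflTransGen.single ⟨hadj, hy⟩).trans hpath⟩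

/-- **Soundness of the growth rule**: every cell of `growB D y i` is joined to `i` by open edges. -/
theorem growB_sound [Fintype Φ] (D : ℕ) (y : Φ × Φ → Bool) (i j : Φ) (hj : j ∈ growB SA D y i) :
    Relation.ReflTransGen (fun a b => (bipGraph SA).Adj a b ∧ y (ekB SA a b) = true) i j := by
  obtain ⟨i', hi', h⟩ := growL_joined y D _ _ _ j hj
  rw [mem_singleton] at hi'
  subst hi'
  exact h

/-! ### Supports: which keys a level computation reads -/

/-- Configurations agreeing on the keys between `L` and `R` have the same next level. -/
theorem nxt_congr {y y' : Φ × Φ → Bool} {L R : Finset Φ} (h : ∀ u ∈ L, ∀ w ∈ R, y (ekB SA u w) = y' (ekB SA u w)) :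
    nxt SA y L R = nxt SA y' L R := by
  unfold nxt
  refine filter_congr fun w hw => ?_
  constructor
  · rintro ⟨u, hu, hadj, hy⟩; exact ⟨u, hu, hadj, (h u hu w hw) ▸ hy⟩
  · rintro ⟨u, hu, hadj, hy⟩; exact ⟨u, hu, hadj, (h u hu w hw).symm ▸ hy⟩

/-- Configurations agreeing on all keys between cells of `L ∪ RX ∪ RY` grow the same levels. -/
theorem growL_congr {y y' : Φ × Φ → Bool} : ∀ (D : ℕ) (L RX RY : Finset Φ),
    (∀ u ∈ L ∪ RX ∪ RY, ∀ w ∈ L ∪ RX ∪ RY, y (ekB SA u w) = y' (ekB SA u w)) →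
      growL SA y D L RX RY = growL SA y' D L RX RY
  | 0, L, RX, RY, _ => rfl
  | D + 1, L, RX, RY, h => by
    simp only [growL]
    have hN : nxt SA y L RY = nxt SA y' L RY :=
      nxt_congr fun u hu w hw => h u (by simp [hu]) w (by simp [hw])
    rw [← hN]
    congr 1
    refine growL_congr D _ _ _ fun u hu w hw => h u ?_ w ?_
    · rcases mem_union.1 hu with hu | hu
      · rcases mem_union.1 hu with hu | hu
        · exact mem_union_right _ (nxt_subset y L RY hu)
        · exact mem_union_right _ (sdiff_subset hu)
      · exact mem_union_left _ (mem_union_right _ hu)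
    · rcases mem_union.1 hw with hw | hw
      · rcases mem_union.1 hw with hw | hw
        · exact mem_union_right _ (nxt_subset y L RY hw)
        · exact mem_union_right _ (sdiff_subset hw)
      · exact mem_union_left _ (mem_union_right _ hw)

variable (SA) in
/-- The keys between `L` and `R`. -/
def keysLR (L R : Finset Φ) : Finset (Φ × Φ) := (L ×ˢ R).image fun q => ekB SA q.1 q.2

/-- A key between `L` and `R` has (as a pair) both components in `L ∪ R`, one of them in `L`. -/
theorem mem_keysLR_imp {L R : Finset Φ} {k : Φ × Φ} (hk : k ∈ keysLR SA L R) :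
    (k.1 ∈ L ∧ k.2 ∈ R) ∨ (k.1 ∈ R ∧ k.2 ∈ L) := by
  unfold keysLR at hk
  obtain ⟨q, hq, rfl⟩ := mem_image.1 hk
  obtain ⟨h1, h2⟩ := mem_product.1 hq
  rcases ekB_mem (SA := SA) q.1 q.2 with h | h <;> rw [h]
  · exact Or.inl ⟨h1, h2⟩
  · exact Or.inr ⟨h2, h1⟩

/-- A key between two cells of `A` is not a key between `L` and `R` when `L` is disjoint from `A`. -/
theorem ekB_not_mem_keysLR {L R A : Finset Φ} (hLA : Disjoint L A) {u w : Φ} (hu : u ∈ A) (hw : w ∈ A) :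
    ekB SA u w ∉ keysLR SA L R := by
  intro hk
  rcases ekB_mem (SA := SA) u w with h | h <;> rw [h] at hk <;>
    rcases mem_keysLR_imp (SA := SA) hk with ⟨h1, -⟩ | ⟨-, h2⟩
  · exact Finset.disjoint_left.1 hLA h1 hu
  · exact Finset.disjoint_left.1 hLA h2 hw
  · exact Finset.disjoint_left.1 hLA h1 hw
  · exact Finset.disjoint_left.1 hLA h2 hu

/-! ### The law of one level -/

section OneLevel

variable (p : ℝ) {L : Finset Φ}


variable (SA) in
/-- The keys from `L` to the cell `w`. -/
def keysTo (L : Finset Φ) (w : Φ) : Finset (Φ × Φ) := L.image fun u => ekB SA u w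

/-- `#keysTo L w = #L` for `w ∉ L`. -/
theorem card_keysTo {w : Φ} (hw : w ∉ L) : (keysTo SA L w).card = L.card := by
  unfold keysTo
  exact card_image_of_injOn fun u hu u' hu' h =>
    ekB_inj_left (ne_of_mem_of_not_mem hu hw) (ne_of_mem_of_not_mem hu' hw) h

/-- The event "some cell of `L` has an open edge to `w`" reads only `keysTo L w`. -/
theorem hit_congr {y y' : Φ × Φ → Bool} {w : Φ} (h : ∀ k ∈ keysTo SA L w, y k = y' k) :
    (∃ u ∈ L, (bipGraph SA).Adj u w ∧ y (ekB SA u w) = true) ↔ (∃ u ∈ L, (bipGraph SA).Adj u w ∧ y' (ekB SA u w) = true) := by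
  have hk : ∀ u ∈ L, y (ekB SA u w) = y' (ekB SA u w) := fun u hu => h _ (mem_image_of_mem _ hu)
  constructor
  · rintro ⟨u, hu, hadj, hy⟩; exact ⟨u, hu, hadj, (hk u hu) ▸ hy⟩
  · rintro ⟨u, hu, hadj, hy⟩; exact ⟨u, hu, hadj, (hk u hu).symm ▸ hy⟩

/-- **The law of one hit**: if every cell of `L` is adjacent to `w ∉ L`, the probability that no cell of `L` has an open
edge to `w` is `(1-p)^{#L}`. -/
theorem sum_wt_noHit [Fintype Φ] {w : Φ} (hw : w ∉ L) (hLw : ∀ u ∈ L, (bipGraph SA).Adj u w) :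
    ∑ y : Φ × Φ → Bool, wt p y * (if (∃ u ∈ L, (bipGraph SA).Adj u w ∧ y (ekB SA u w) = true) then (0 : ℝ) else 1) =
      (1 - p) ^ L.card := by
  classical
  rw [← card_keysTo (SA := SA) hw, ← sum_wt_filter_all_false p (keysTo SA L w), Finset.sum_filter]
  refine Finset.sum_congr rfl fun y _ => ?_
  by_cases h : ∃ u ∈ L, (bipGraph SA).Adj u w ∧ y (ekB SA u w) = true
  · rw [if_pos h, if_neg, mul_zero]
    obtain ⟨u, hu, -, hy⟩ := h
    intro hall
    have := hall _ (mem_image_of_mem _ hu)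
    rw [this] at hy; exact Bool.false_ne_true hy
  · rw [if_neg h, if_pos, mul_one]
    intro k hk
    obtain ⟨u, hu, rfl⟩ := mem_image.1 hk
    by_contra hy
    exact h ⟨u, hu, hLw u hu, by simpa using hy⟩

end OneLevel

end BFib

end Summit.CriticalPhenomena.PercolationContinuityZ3.Theorems.Pcint

end
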